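import Literature.Computability.Complexity.SymmetricColourRefinement
import Literature.Combinatorics.SimpleGraph.ColourRefinementOrder
import HarnessLib

/-!
# Symmetric threshold circuits for ordered colour refinement and the canonical form, III:
# semantics of the rounds

Continuation of `SymmetricColourRefinement.lean`. For the DAG `SymCR.crDAG m T o` evaluated on a
matrix `x : Fin m × Fin m → Bool`, with `G = Gr x = SimpleGraph.fromRel (x · · = true)` and
`ocr G t` the ordered colour refinement of
`Literature/Combinatorics/SimpleGraph/ColourRefinementOrder.lean`,
we prove that every gate computes what its name says (`SymCR.val_eq_iff`, `SymCR.val_lt_iff`):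

  `eq t u v ↦ [ocr G t u = ocr G t v]`,  `lt t u v ↦ [ocr G t u < ocr G t v]`  (`t ≤ T`),

by induction on the round, the step being the evaluation of the counting gadget: the majority
gate `cge t u v w` over the `m` wires `[w' ∈ N(u) ∩ [w]ₜ]` and the `m` wires `¬[w' ∈ N(v) ∩ [w]ₜ]`
fires iff `#(N(v) ∩ [w]ₜ) ≤ #(N(u) ∩ [w]ₜ)` (`SymCR.val_cge`), whence the lexicographic clause
`lex t u v ↦ ProfLT G (ocr G t) u v` and, by `ocr_succ_lt_iff` / `ocr_succ_eq_iff`, the next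
round. The rank and output layers are evaluated in `SymmetricColourRefinementCanonical.lean`.

## References

* [AndersonDawar2016] M. Anderson, A. Dawar, *On symmetric circuits and fixed-point logics*,
  Theory Comput. Syst. 60 (2017), Thm 1, §3.
* [CaiFurerImmerman1992] Cai–Fürer–Immerman, Combinatorica 12 (1992), §5 (vertex refinement).
-/

namespace Literature.Computability.Complexity

open Finset Literature.Combinatorics.SimpleGraph

namespace SymCR

open Node
open scoped Classical

variable {m T : ℕ}

/-! ### Generalities on gate values -/

/-- The graph decoded from the matrix `x` (route convention). [folklore] -/
abbrev Gr (x : Fin m × Fin m → Bool) : SimpleGraph (Fin m) :=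
  SimpleGraph.fromRel fun u v => x (u, v) = true

/-- A Boolean equals `decide P` as soon as it is `true` exactly when `P`. [folklore] -/
theorem eq_decide_of_iff {b : Bool} {P : Prop} [Decidable P] (h : b = true ↔ P) : b = decide P := by
  cases b
  · symm; rw [decide_eq_false_iff_not]; exact fun hP => Bool.false_ne_true (h.2 hP)
  · symm; exact decide_eq_true (h.1 rfl)

/-- The number of ones of a concatenated tuple (private copy of `LabelledArithCircuit.numOnes_append`,
`AlgebraicComplexity/SymmetricThresholdTranslation.lean`, not imported to keep the closure small). [folklore] -/
private theorem numOnes_append {n₁ n₂ : ℕ} (a : Fin n₁ → Bool) (b : Fin n₂ → Bool) :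
    GateFn.numOnes (Fin.append a b) = GateFn.numOnes a + GateFn.numOnes b := by
  unfold GateFn.numOnes
  rw [Finset.card_filter, Finset.card_filter, Finset.card_filter, Fin.sum_univ_add]
  simp only [Fin.append_left, Fin.append_right]

/-- The number of ones of a tuple of truth values is the number of true positions. [folklore] -/
theorem numOnes_decide {n : ℕ} (P : Fin n → Prop) [DecidablePred P] :
    GateFn.numOnes (fun i => decide (P i)) = (univ.filter P).card := by
  unfold GateFn.numOnes
  congr 1
  ext i
  simp

/-- The padding count: `#{k < m | k + i < m} = m - i` for `i ≤ m`. [folklore] -/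
theorem card_filter_add_lt {i : ℕ} (hi : i ≤ m) :
    (univ.filter fun k : Fin m => (k : ℕ) + i < m).card = m - i := by
  have heq : (univ.filter fun k : Fin m => (k : ℕ) + i < m) =
      univ.image (Fin.castLE (Nat.sub_le m i) : Fin (m - i) → Fin m) := by
    ext k
    simp only [mem_filter, mem_univ, true_and, mem_image]
    constructor
    · intro hk
      exact ⟨⟨k, by omega⟩, Fin.ext rfl⟩
    · rintro ⟨k', rfl⟩
      have := k'.2
      simp only [Fin.val_castLE]
      omega
  rw [heq, Finset.card_image_of_injective _ (Fin.castLE_injective _), Finset.card_univ,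
    Fintype.card_fin]

section GateShapes

variable (V : W m T → Bool)

/-- A binary conjunction reads its two arguments. [folklore] -/
theorem and_two_iff (f : Fin 2 → W m T) :
    (GateFn.and 2).2 (fun a => V (f a)) = true ↔ (V (f 0) = true ∧ V (f 1) = true) := by
  show decide (∀ a : Fin 2, V (f a) = true) = true ↔ _
  rw [decide_eq_true_iff, Fin.forall_fin_two]

/-- A ternary conjunction reads its three arguments. [folklore] -/
theorem and_three_iff (f : Fin 3 → W m T) :
    (GateFn.and 3).2 (fun a => V (f a)) = true ↔ (V (f 0) = true ∧ V (f 1) = true ∧ V (f 2) = true) := by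
  show decide (∀ a : Fin 3, V (f a) = true) = true ↔ _
  rw [decide_eq_true_iff, Fin.forall_fin_succ, Fin.forall_fin_two]
  exact Iff.rfl

/-- A binary disjunction reads its two arguments. [folklore] -/
theorem or_two_iff (f : Fin 2 → W m T) :
    (GateFn.or 2).2 (fun a => V (f a)) = true ↔ (V (f 0) = true ∨ V (f 1) = true) := by
  show decide (∃ a : Fin 2, V (f a) = true) = true ↔ _
  rw [decide_eq_true_iff, Fin.exists_fin_two]

/-- A negation gate negates its argument. [folklore] -/
theorem not_apply (f : Fin 1 → W m T) : GateFn.not.2 (fun a => V (f a)) = !(V (f 0)) := rfl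

/-- An unbounded conjunction. [folklore] -/
theorem and_fin_iff {n : ℕ} (f : Fin n → W m T) :
    (GateFn.and n).2 (fun a => V (f a)) = true ↔ ∀ a, V (f a) = true := by
  show decide (∀ a : Fin n, V (f a) = true) = true ↔ _
  rw [decide_eq_true_iff]

/-- An unbounded disjunction. [folklore] -/
theorem or_fin_iff {n : ℕ} (f : Fin n → W m T) :
    (GateFn.or n).2 (fun a => V (f a)) = true ↔ ∃ a, V (f a) = true := by
  show decide (∃ a : Fin n, V (f a) = true) = true ↔ _
  rw [decide_eq_true_iff]

/-- A majority gate counts ones. [folklore] -/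
theorem maj_iff {n : ℕ} (f : Fin n → W m T) :
    (GateFn.maj n).2 (fun a => V (f a)) = true ↔ n ≤ 2 * GateFn.numOnes (fun a => V (f a)) := by
  show decide (n ≤ 2 * GateFn.numOnes fun a => V (f a)) = true ↔ _
  rw [decide_eq_true_iff]

/-- Reading a two-block tuple of wires. [folklore] -/
theorem comp_append (A B : Fin m → W m T) :
    (fun a => V (Fin.append A B a)) = Fin.append (fun w' => V (A w')) (fun w' => V (B w')) := by
  funext a
  induction a using Fin.addCases with
  | left i => rw [Fin.append_left, Fin.append_left]
  | right j => rw [Fin.append_right, Fin.append_right]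

/-- A two-block majority gate `MAJ_{2m}` counts the ones of both blocks. [folklore] -/
theorem maj_append_iff (A B : Fin m → W m T) :
    (GateFn.maj (m + m)).2 (fun a => V (Fin.append A B a)) = true ↔
      m + m ≤ 2 * (GateFn.numOnes (fun w' => V (A w')) + GateFn.numOnes (fun w' => V (B w'))) := by
  rw [maj_iff, comp_append, numOnes_append]

end GateShapes

section Values

variable (o : Fin m × Fin m) (x : Fin m × Fin m → Bool)

/-- The constant-true gate. [folklore] -/
theorem val_tt : (crDAG m T o).val x tt = true := by
  rw [GateDAG.val_eq]
  show decide (∀ a : Fin 0, GateDAG.wire x ((crDAG m T o).val x) (Fin.elim0 a) = true) = true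
  simp

/-- The constant-false gate. [folklore] -/
theorem val_ff : (crDAG m T o).val x ff = false := by
  rw [GateDAG.val_eq]
  show decide (∃ a : Fin 0, GateDAG.wire x ((crDAG m T o).val x) (Fin.elim0 a) = true) = false
  simp

/-- The symmetrised-entry gate `e u v = x(u,v) ∨ x(v,u)`. [folklore] -/
theorem val_e (u v : Fin m) :
    (crDAG m T o).val x (e u v) = true ↔ (x (u, v) = true ∨ x (v, u) = true) := by
  rw [GateDAG.val_eq]
  show (GateFn.or 2).2 (fun a => GateDAG.wire x ((crDAG m T o).val x)
    (if (a : ℕ) = 0 then Sum.inl (u, v) else Sum.inl (v, u))) = true ↔ _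
  rw [or_two_iff]
  simp

/-- **The adjacency gate computes adjacency in `Gr x`.** [folklore] -/
theorem val_adj (u v : Fin m) : (crDAG m T o).val x (adj u v) = true ↔ (Gr x).Adj u v := by
  rw [GateDAG.val_eq, SimpleGraph.fromRel_adj]
  show (GateFn.and 2).2 (fun a => GateDAG.wire x ((crDAG m T o).val x)
    (if (a : ℕ) = 0 then Sum.inr (e u v) else (if u = v then Sum.inr ff else Sum.inr tt))) = true ↔ _
  rw [and_two_iff]
  simp only [Fin.val_zero, ↓reduceIte, Fin.val_one, one_ne_zero, GateDAG.wire_inr, val_e]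
  by_cases h : u = v
  · simp [h, val_ff]
  · simp [h, val_tt]

/-! ### Round `0` -/

/-- `eq 0 u v` is `true` (all vertices start with colour `0`). [folklore] -/
theorem val_eq_zero (h0 : 0 < T + 1) (u v : Fin m) : (crDAG m T o).val x (eq ⟨0, h0⟩ u v) = true := by
  rw [GateDAG.val_eq]
  show decide (∀ a : Fin (m + 1), GateDAG.wire x ((crDAG m T o).val x) (Sum.inr tt) = true) = true
  simp [val_tt]

/-- `lt 0 u v` is `false`. [folklore] -/
theorem val_lt_zero (h0 : 0 < T + 1) (u v : Fin m) : (crDAG m T o).val x (lt ⟨0, h0⟩ u v) = false := by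
  rw [GateDAG.val_eq]
  show decide (∃ a : Fin 2, GateDAG.wire x ((crDAG m T o).val x) (Sum.inr ff) = true) = false
  simp [val_ff]

/-! ### The step: round `t + 1` from round `t` -/

section Step

variable {o x} (s : Fin T)
  (hE : ∀ a b : Fin m, (crDAG m T o).val x (eq s.castSucc a b) = true ↔ ocr (Gr x) s a = ocr (Gr x) s b)
  (hL : ∀ a b : Fin m, (crDAG m T o).val x (lt s.castSucc a b) = true ↔ ocr (Gr x) s a < ocr (Gr x) s b)

include hE in
/-- `ae t u w' w`: `w'` is a neighbour of `u` in the round-`t` class of `w`. [folklore] -/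
theorem val_ae (u w' w : Fin m) : (crDAG m T o).val x (ae s u w' w) = true ↔
    ((Gr x).Adj u w' ∧ ocr (Gr x) s w' = ocr (Gr x) s w) := by
  rw [GateDAG.val_eq]
  show (GateFn.and 2).2 (fun a => GateDAG.wire x ((crDAG m T o).val x)
    (if (a : ℕ) = 0 then Sum.inr (adj u w') else Sum.inr (eq s.castSucc w' w))) = true ↔ _
  rw [and_two_iff]
  simp only [Fin.val_zero, ↓reduceIte, Fin.val_one, one_ne_zero, GateDAG.wire_inr, val_adj, hE]

include hE in
/-- `nae` is the negation of `ae`. [folklore] -/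
theorem val_nae (u w' w : Fin m) : (crDAG m T o).val x (nae s u w' w) = true ↔
    ¬ ((Gr x).Adj u w' ∧ ocr (Gr x) s w' = ocr (Gr x) s w) := by
  rw [GateDAG.val_eq, ← val_ae s hE u w' w]
  show (GateFn.not.2 fun a => GateDAG.wire x ((crDAG m T o).val x) (Sum.inr (ae s u w' w))) = true ↔ _
  rw [not_apply, GateDAG.wire_inr]
  cases (crDAG m T o).val x (ae s u w' w) <;> simp

include hE in
/-- **The counting gadget**: `cge t u v w` fires iff `v` has at most as many neighbours in the
round-`t` class of `w` as `u` does. [cite: AndersonDawar2016, §3 (counting by threshold gates)] -/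
theorem val_cge (u v w : Fin m) : (crDAG m T o).val x (cge s u v w) = true ↔
    nbrCount (Gr x) (ocr (Gr x) s) v (ocr (Gr x) s w) ≤ nbrCount (Gr x) (ocr (Gr x) s) u (ocr (Gr x) s w) := by
  rw [GateDAG.val_eq]
  show (GateFn.maj (m + m)).2 (fun a => GateDAG.wire x ((crDAG m T o).val x)
    (Fin.append (fun w' => Sum.inr (ae s u w' w)) (fun w' => Sum.inr (nae s v w' w)) a)) = true ↔ _
  rw [maj_append_iff]
  simp only [GateDAG.wire_inr]
  have hA : (fun w' => (crDAG m T o).val x (ae s u w' w)) =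
      fun w' => decide ((Gr x).Adj u w' ∧ ocr (Gr x) s w' = ocr (Gr x) s w) :=
    funext fun w' => eq_decide_of_iff (val_ae s hE u w' w)
  have hB : (fun w' => (crDAG m T o).val x (nae s v w' w)) =
      fun w' => decide (¬ ((Gr x).Adj v w' ∧ ocr (Gr x) s w' = ocr (Gr x) s w)) :=
    funext fun w' => eq_decide_of_iff (val_nae s hE v w' w)
  rw [hA, hB, numOnes_decide, numOnes_decide]
  have hsum := Finset.card_filter_add_card_filter_not
    (s := (univ : Finset (Fin m))) (fun w' => (Gr x).Adj v w' ∧ ocr (Gr x) s w' = ocr (Gr x) s w)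
  rw [Finset.card_univ, Fintype.card_fin] at hsum
  unfold nbrCount
  constructor
  · intro h; omega
  · intro h; omega

include hE in
/-- `ceq t u v w`: equal neighbour counts into the class of `w`. [folklore] -/
theorem val_ceq (u v w : Fin m) : (crDAG m T o).val x (ceq s u v w) = true ↔
    nbrCount (Gr x) (ocr (Gr x) s) u (ocr (Gr x) s w) = nbrCount (Gr x) (ocr (Gr x) s) v (ocr (Gr x) s w) := by
  rw [GateDAG.val_eq]
  show (GateFn.and 2).2 (fun a => GateDAG.wire x ((crDAG m T o).val x)
    (if (a : ℕ) = 0 then Sum.inr (cge s u v w) else Sum.inr (cge s v u w))) = true ↔ _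
  rw [and_two_iff]
  simp only [Fin.val_zero, ↓reduceIte, Fin.val_one, one_ne_zero, GateDAG.wire_inr, val_cge s hE]
  exact ⟨fun h => le_antisymm h.2 h.1, fun h => ⟨h ▸ le_rfl, h ▸ le_rfl⟩⟩

include hE in
/-- `clt t u v w`: strictly fewer neighbours into the class of `w`. [folklore] -/
theorem val_clt (u v w : Fin m) : (crDAG m T o).val x (clt s u v w) = true ↔
    nbrCount (Gr x) (ocr (Gr x) s) u (ocr (Gr x) s w) < nbrCount (Gr x) (ocr (Gr x) s) v (ocr (Gr x) s w) := by
  rw [GateDAG.val_eq, ← not_le, ← val_cge s hE u v w]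
  show (GateFn.not.2 fun a => GateDAG.wire x ((crDAG m T o).val x) (Sum.inr (cge s u v w))) = true ↔ _
  rw [not_apply, GateDAG.wire_inr]
  cases (crDAG m T o).val x (cge s u v w) <;> simp

include hL in
/-- `nlt t w' w`: the class of `w'` is not below that of `w`. [folklore] -/
theorem val_nlt (w' w : Fin m) : (crDAG m T o).val x (nlt s w' w) = true ↔
    ¬ (ocr (Gr x) s w' < ocr (Gr x) s w) := by
  rw [GateDAG.val_eq, ← hL w' w]
  show (GateFn.not.2 fun a => GateDAG.wire x ((crDAG m T o).val x) (Sum.inr (lt s.castSucc w' w))) = true ↔ _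
  rw [not_apply, GateDAG.wire_inr]
  cases (crDAG m T o).val x (lt s.castSucc w' w) <;> simp

include hE hL in
/-- `imp t u v w w'`: if the class of `w'` is below that of `w` then the counts of `u` and `v`
into it agree. [folklore] -/
theorem val_imp (u v w w' : Fin m) : (crDAG m T o).val x (imp s u v w w') = true ↔
    (ocr (Gr x) s w' < ocr (Gr x) s w →
      nbrCount (Gr x) (ocr (Gr x) s) u (ocr (Gr x) s w') = nbrCount (Gr x) (ocr (Gr x) s) v (ocr (Gr x) s w')) := by
  rw [GateDAG.val_eq]
  show (GateFn.or 2).2 (fun a => GateDAG.wire x ((crDAG m T o).val x)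
    (if (a : ℕ) = 0 then Sum.inr (nlt s w' w) else Sum.inr (ceq s u v w'))) = true ↔ _
  rw [or_two_iff]
  simp only [Fin.val_zero, ↓reduceIte, Fin.val_one, one_ne_zero, GateDAG.wire_inr, val_nlt s hL,
    val_ceq s hE]
  exact (imp_iff_not_or).symm

include hE hL in
/-- `allb t u v w`: the counts of `u` and `v` agree on every class below that of `w`. [folklore] -/
theorem val_allb (u v w : Fin m) : (crDAG m T o).val x (allb s u v w) = true ↔
    ∀ w', ocr (Gr x) s w' < ocr (Gr x) s w →
      nbrCount (Gr x) (ocr (Gr x) s) u (ocr (Gr x) s w') = nbrCount (Gr x) (ocr (Gr x) s) v (ocr (Gr x) s w') := by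
  rw [GateDAG.val_eq]
  show (GateFn.and m).2 (fun a => GateDAG.wire x ((crDAG m T o).val x) (Sum.inr (imp s u v w a))) = true ↔ _
  rw [and_fin_iff]
  simp only [GateDAG.wire_inr, val_imp s hE hL]

include hE hL in
/-- **The lexicographic clause**: `lex t u v` fires iff the count vector of `u` precedes that of
`v` (`ProfLT`). [cite: CaiFurerImmerman1992, §5 ("sort these new colors lexicographically")] -/
theorem val_lex (u v : Fin m) : (crDAG m T o).val x (lex s u v) = true ↔
    ProfLT (Gr x) (ocr (Gr x) s) u v := by
  rw [GateDAG.val_eq]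
  show (GateFn.or m).2 (fun a => GateDAG.wire x ((crDAG m T o).val x) (Sum.inr (lexw s u v a))) = true ↔ _
  rw [or_fin_iff]
  refine exists_congr fun w => ?_
  rw [GateDAG.wire_inr, GateDAG.val_eq]
  show (GateFn.and 2).2 (fun a => GateDAG.wire x ((crDAG m T o).val x)
    (if (a : ℕ) = 0 then Sum.inr (clt s u v w) else Sum.inr (allb s u v w))) = true ↔ _
  rw [and_two_iff]
  simp only [Fin.val_zero, ↓reduceIte, Fin.val_one, one_ne_zero, GateDAG.wire_inr, val_clt s hE,
    val_allb s hE hL]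

include hE hL in
/-- `lt2 t u v`: tied at round `t` and lexicographically smaller counts. [folklore] -/
theorem val_lt2 (u v : Fin m) : (crDAG m T o).val x (lt2 s u v) = true ↔
    (ocr (Gr x) s u = ocr (Gr x) s v ∧ ProfLT (Gr x) (ocr (Gr x) s) u v) := by
  rw [GateDAG.val_eq]
  show (GateFn.and 2).2 (fun a => GateDAG.wire x ((crDAG m T o).val x)
    (if (a : ℕ) = 0 then Sum.inr (eq s.castSucc u v) else Sum.inr (lex s u v))) = true ↔ _
  rw [and_two_iff]
  simp only [Fin.val_zero, ↓reduceIte, Fin.val_one, one_ne_zero, GateDAG.wire_inr, hE,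
    val_lex s hE hL]

end Step

section Succ

variable {o x} {t : ℕ} (ht : t < T)
  (hE : ∀ a b : Fin m, (crDAG m T o).val x (eq (Fin.castSucc ⟨t, ht⟩) a b) = true ↔
    ocr (Gr x) t a = ocr (Gr x) t b)
  (hL : ∀ a b : Fin m, (crDAG m T o).val x (lt (Fin.castSucc ⟨t, ht⟩) a b) = true ↔
    ocr (Gr x) t a < ocr (Gr x) t b)

include hE hL in
/-- **Round `t + 1`, order**: `lt (t+1) u v ↦ [ocr (t+1) u < ocr (t+1) v]`. [cite: CaiFurerImmerman1992, §5 (vertex refinement)] -/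
theorem val_lt_succ (u v : Fin m) : (crDAG m T o).val x (lt ⟨t + 1, by omega⟩ u v) = true ↔
    ocr (Gr x) (t + 1) u < ocr (Gr x) (t + 1) v := by
  rw [GateDAG.val_eq, ocr_succ_lt_iff]
  show (GateFn.or 2).2 (fun a => GateDAG.wire x ((crDAG m T o).val x)
    (if (a : ℕ) = 0 then Sum.inr (lt ⟨t, by omega⟩ u v) else Sum.inr (lt2 ⟨t, ht⟩ u v))) = true ↔ _
  rw [or_two_iff]
  simp only [Fin.val_zero, ↓reduceIte, Fin.val_one, one_ne_zero, GateDAG.wire_inr,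
    val_lt2 ⟨t, ht⟩ hE hL]
  rw [show (⟨t, by omega⟩ : Fin (T + 1)) = Fin.castSucc ⟨t, ht⟩ from rfl, hL]
  exact Iff.rfl

include hE in
/-- **Round `t + 1`, equality**: `eq (t+1) u v ↦ [ocr (t+1) u = ocr (t+1) v]`. [cite: CaiFurerImmerman1992, §5 (vertex refinement)] -/
theorem val_eq_succ (u v : Fin m) : (crDAG m T o).val x (eq ⟨t + 1, by omega⟩ u v) = true ↔
    ocr (Gr x) (t + 1) u = ocr (Gr x) (t + 1) v := by
  rw [GateDAG.val_eq, ocr_succ_eq_iff]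
  show decide (∀ a : Fin (m + 1), GateDAG.wire x ((crDAG m T o).val x)
    ((Fin.cons (Sum.inr (eq ⟨t, by omega⟩ u v)) (fun k => Sum.inr (ceq ⟨t, ht⟩ u v k)) :
      Fin (m + 1) → W m T) a) = true) = true ↔ _
  rw [decide_eq_true_iff, Fin.forall_fin_succ]
  simp only [Fin.cons_zero, Fin.cons_succ, GateDAG.wire_inr, val_ceq ⟨t, ht⟩ hE]
  rw [show (⟨t, by omega⟩ : Fin (T + 1)) = Fin.castSucc ⟨t, ht⟩ from rfl, hE]

end Succ

/-! ### All rounds -/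

/-- **The refinement gates compute ordered colour refinement**: for every `t ≤ T`,
`eq t u v ↦ [ocr (Gr x) t u = ocr (Gr x) t v]` and `lt t u v ↦ [ocr (Gr x) t u < ocr (Gr x) t v]`.
[cite: AndersonDawar2016, Thm 1 (FPC to symmetric circuits)] -/
theorem val_round : ∀ (t : ℕ) (ht : t < T + 1) (u v : Fin m),
    ((crDAG m T o).val x (eq ⟨t, ht⟩ u v) = true ↔ ocr (Gr x) t u = ocr (Gr x) t v) ∧
      ((crDAG m T o).val x (lt ⟨t, ht⟩ u v) = true ↔ ocr (Gr x) t u < ocr (Gr x) t v)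
  | 0, h0, u, v => by
    refine ⟨?_, ?_⟩
    · rw [val_eq_zero]; simp
    · rw [val_lt_zero]; simp
  | t + 1, ht, u, v => by
    have ht' : t < T := by omega
    have hE : ∀ a b : Fin m, (crDAG m T o).val x (eq (Fin.castSucc ⟨t, ht'⟩) a b) = true ↔
        ocr (Gr x) t a = ocr (Gr x) t b := fun a b => (val_round t (by omega) a b).1
    have hL : ∀ a b : Fin m, (crDAG m T o).val x (lt (Fin.castSucc ⟨t, ht'⟩) a b) = true ↔
        ocr (Gr x) t a < ocr (Gr x) t b := fun a b => (val_round t (by omega) a b).2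
    exact ⟨val_eq_succ ht' hE u v, val_lt_succ ht' hE hL u v⟩

/-- `eq t u v` computes equality of round-`t` colours. [cite: AndersonDawar2016, Thm 1 (FPC to symmetric circuits)] -/
theorem val_eq_iff (t : Fin (T + 1)) (u v : Fin m) :
    (crDAG m T o).val x (eq t u v) = true ↔ ocr (Gr x) t u = ocr (Gr x) t v :=
  (val_round o x t t.2 u v).1

/-- `lt t u v` computes the order of round-`t` colours. [cite: AndersonDawar2016, Thm 1 (FPC to symmetric circuits)] -/
theorem val_lt_iff (t : Fin (T + 1)) (u v : Fin m) :
    (crDAG m T o).val x (lt t u v) = true ↔ ocr (Gr x) t u < ocr (Gr x) t v :=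
  (val_round o x t t.2 u v).2

end Values

end SymCR

end Literature.Computability.Complexity
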